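import Summits.NavierStokesRegularity.FluidComputer.PartialRegularityFace
import Literature.Analysis.FluidPDE.BarkerPrange2020ConcentratingTypeINoSupport
import HarnessLib

/-!
# Fluid computer — the level dictionary, TYPE-I CONCENTRATING-BALL FACE (L55): under a global Type-I bound the
# vorticity is unbounded, and its direction incoherent, INSIDE the shrinking self-similar balls around the focus

HONEST FRAMING (cell `pub-fluidc`, verbatim): *low prior, high value-of-information experiment on Tao's
machine paradigm; NOT a claim that NS blows up.* Theorem side of the cell; nothing here is evidence of blow-up.

Barker–Prange 2020, Theorem 3 (whole space, (5.3)–(5.4)) is PROVED in the tree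
(`barkerPrange2020_alignment_concentrating_typeI_holds`); its printed hypothesis `u₀ ∈ C₀^∞` is unused, and this
generation's Literature file `BarkerPrange2020ConcentratingTypeINoSupport` records the support-free form
(`barkerPrange2020_alignment_concentrating_typeI_general`). Read CONTRAPOSITIVELY at the focus `x₀` of a realised
blow-up (a backward singular point exists: L37 `PartialRegularityFace.exists_isBackwardSingularPoint`), for every
maximal smooth solution of the unforced Navier–Stokes system on `ℝ³ × [0, T)` (`ν > 0`), Leray–Hopf from `u 0`, which
obeys the GLOBAL TYPE-I BOUND `‖u(t, x)‖ ≤ M/√(T − t)` on `(0, T) × ℝ³`: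

* `typeI_concentratingBall_vorticity_unbounded` (**L55 — VORTICITY UNBOUNDED IN THE SELF-SIMILAR BALLS**): there is
  `δ > 0` and a point `x₀` such that along EVERY strictly increasing sequence `t_n → T` in `(0, T)` the vorticity is
  unbounded on `⋃_n B(x₀, δ√(ν(T − t_n))) × {t_n}`: for every `K` some `n` and some `x ∈ B(x₀, δ√(ν(T − t_n)))` have
  `K < ‖curl u(t_n)(x)‖`;
* `typeI_concentratingBall_vorticity_window` (**L55′ — window form**): for every `K` and every `t₁ < T` there is
  `t ∈ (t₁, T)` and `x ∈ B(x₀, δ√(ν(T − t)))` with `K < ‖curl u(t)(x)‖` — `limsup_{t↑T} max_{B(x₀, δ√(ν(T−t)))} |ω| = ∞`;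
* `typeI_concentratingBall_direction` (**L55″ — NO MODULUS OF THE DIRECTION IN THE SELF-SIMILAR BALLS**): for every
  intensity threshold `d > 0`, every modulus `η` (continuous, `η 0 = 0`) and every `t₁ < T` there is `t ∈ (t₁, T)`
  at which the slice is NOT `η`-aligned on `B(x₀, δ√(ν(T − t))) ∩ {|ω| > d}` (`¬ SliceAligned ν T u x₀ δ d η t`);
* `typeI_concentratingBall_face` — assembled.

Reading for the machine paradigm. L43 (Barker–Prange Thm. 2) locked critical `L³` mass in the parabolic balls around
the focus and L49 (Giga–Miura) broke every modulus of the vortex direction over the intense set in a FIXED ball; L55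
places both the amplitude and the incoherence INSIDE THE SHRINKING BALLS `|x − x₀| < δ√(ν(T − t))`: a Type-I design
must keep re-creating unbounded, directionally incoherent vorticity at the self-similar scale around one point.
HONEST SIZE NOTE: CONDITIONAL on a GLOBAL Type-I bound (L40: axisymmetric blow-ups are never Type I); `δ` inexplicit
(the tree's proof witnesses `δ = 1` but the statement keeps `∃ δ`); class = `ℝ³` finite energy. Words and shapes for the
writer, never numbers at the cell's levels. Necessity only; nothing about sufficiency. 0 sorry; no new definitions,
no named facts.

## References

* T. Barker, C. Prange, Arch. Ration. Mech. Anal. 235 (2020) 881–926 = arXiv:1906.08225, §5.2 Thm. 3, Remark 15.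
  [BarkerPrange2020Alignment]
* L. Caffarelli, R. Kohn, L. Nirenberg, Comm. Pure Appl. Math. 35 (1982) 771–831, Thm. B. [CKN1982]
-/

noncomputable section

open MeasureTheory Set Function Filter Topology Metric
open scoped ENNReal NNReal
open Literature.Analysis.FluidPDE Literature.Analysis.FunctionSpaces
open Summit.NavierStokesRegularity.FluidComputer.PartialRegularityFace

namespace Summit.NavierStokesRegularity.FluidComputer.TypeIConcentratingBallFace

/-- A strictly increasing sequence in `(t₁, T)` converging to `T`: `t_n = T − (T − t₁)/2^{n+1}`. [folklore] -/
theorem exists_seq_Ioo_tendsto {t₁ T : ℝ} (h : t₁ < T) :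
    ∃ s : ℕ → ℝ, (∀ n, s n ∈ Ioo t₁ T) ∧ StrictMono s ∧ Tendsto s atTop (𝓝 T) := by
  refine ⟨fun n => T - (T - t₁) / 2 ^ (n + 1), fun n => ⟨?_, ?_⟩, ?_, ?_⟩
  · have h2 : (T - t₁) / 2 ^ (n + 1) < T - t₁ := by
      rw [div_lt_iff₀ (by positivity)]
      have : (1 : ℝ) < 2 ^ (n + 1) := one_lt_pow₀ (by norm_num) (by omega)
      nlinarith
    linarith
  · have : 0 < (T - t₁) / 2 ^ (n + 1) := by have := sub_pos.2 h; positivity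
    linarith
  · refine strictMono_nat_of_lt_succ fun n => ?_
    have hTt : 0 < T - t₁ := sub_pos.2 h
    have : (T - t₁) / 2 ^ (n + 1 + 1) < (T - t₁) / 2 ^ (n + 1) := by
      apply div_lt_div_of_pos_left hTt (by positivity)
      exact pow_lt_pow_right₀ (by norm_num) (by omega)
    linarith
  · have h1 : Tendsto (fun n : ℕ => (T - t₁) / 2 ^ (n + 1)) atTop (𝓝 0) := by
      have h2 : Tendsto (fun n : ℕ => ((1 : ℝ) / 2) ^ (n + 1)) atTop (𝓝 0) :=
        (tendsto_pow_atTop_nhds_zero_of_lt_one (by norm_num) (by norm_num)).comp (tendsto_add_atTop_nat 1)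
      have h3 := h2.const_mul (T - t₁)
      rw [mul_zero] at h3
      refine h3.congr fun n => ?_
      rw [one_div, inv_pow, div_eq_mul_inv]
    have h4 : Tendsto (fun n : ℕ => T - (T - t₁) / 2 ^ (n + 1)) atTop (𝓝 (T - 0)) :=
      tendsto_const_nhds.sub h1
    rw [sub_zero] at h4
    exact h4

/-- **L55 — UNDER GLOBAL TYPE I THE VORTICITY IS UNBOUNDED IN THE SELF-SIMILAR BALLS AROUND THE FOCUS.** For every
`ν > 0`, `T > 0`, `M`, and every maximal smooth solution `(u, p)` of the unforced Navier–Stokes system on `ℝ³ × [0, T)`,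
Leray–Hopf from `u 0`, with the global Type-I bound `‖u(t, x)‖ ≤ M/√(T − t)` on `(0, T)`: there are `δ > 0` and a point
`x₀` (a backward singular point) such that for EVERY strictly increasing sequence `t_n → T` in `(0, T)` and every `K`,
some `n` and some `x ∈ B(x₀, δ√(ν(T − t_n)))` have `K < ‖curl u(t_n)(x)‖` (Barker–Prange Thm. 3 (5.3) read at the
singular point of L37). [cite: BarkerPrange2020Alignment, Thm. 3 (5.3) and Remark 15 (arXiv:1906.08225 §5.2 p. 18)]
[cite: CKN1982, Theorem B] -/
theorem typeI_concentratingBall_vorticity_unbounded {ν T M : ℝ} (hν : 0 < ν) (hT : 0 < T)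
    {u : ℝ → EuclideanSpace ℝ (Fin 3) → EuclideanSpace ℝ (Fin 3)} {p : ℝ → EuclideanSpace ℝ (Fin 3) → ℝ}
    (hmax : IsMaximalSmoothSolution ν 0 u p T) (hLH : IsLerayHopfOn T ν 0 (u 0) u)
    (hI : ∀ t ∈ Ioo 0 T, ∀ x : EuclideanSpace ℝ (Fin 3), ‖u t x‖ ≤ M / Real.sqrt (T - t)) :
    ∃ δ : ℝ, 0 < δ ∧ ∃ x₀ : EuclideanSpace ℝ (Fin 3), IsBackwardSingularPoint u ((T : ℝ), x₀) ∧
      ∀ s : ℕ → ℝ, (∀ n, s n ∈ Ioo 0 T) → StrictMono s → Tendsto s atTop (𝓝 T) →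
        ∀ K : ℝ, ∃ n : ℕ, ∃ x ∈ ball x₀ (δ * Real.sqrt (ν * (T - s n))), K < ‖curl (u (s n)) x‖ := by
  obtain ⟨δ, hδ, H⟩ := barkerPrange2020_alignment_concentrating_typeI_general ν T M hν hT u p hmax.1 hLH hI
  obtain ⟨x₀, hsing⟩ := exists_isBackwardSingularPoint hν hT hmax hLH
  refine ⟨δ, hδ, x₀, hsing, fun s hs hmono hsT K => ?_⟩
  by_contra hK
  push Not at hK
  exact (H x₀ s hs hmono hsT).1 ⟨K, fun n x hx => hK n x hx⟩ hsing

/-- **L55′ — WINDOW FORM**: with `δ`, `x₀` as in `typeI_concentratingBall_vorticity_unbounded`, for every `K` and every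
`t₁ < T` there is `t ∈ (t₁, T)` (also `t > 0`) and `x ∈ B(x₀, δ√(ν(T − t)))` with `K < ‖curl u(t)(x)‖` — the maximum of
`|ω|` over the shrinking self-similar ball around the focus is unbounded on every terminal window (apply L55 to a
sequence inside `(max t₁ 0, T)`). [cite: BarkerPrange2020Alignment, Thm. 3 (5.3) and Remark 15 (arXiv:1906.08225 §5.2 p. 18)] -/
theorem typeI_concentratingBall_vorticity_window {ν T M : ℝ} (hν : 0 < ν) (hT : 0 < T)
    {u : ℝ → EuclideanSpace ℝ (Fin 3) → EuclideanSpace ℝ (Fin 3)} {p : ℝ → EuclideanSpace ℝ (Fin 3) → ℝ}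
    (hmax : IsMaximalSmoothSolution ν 0 u p T) (hLH : IsLerayHopfOn T ν 0 (u 0) u)
    (hI : ∀ t ∈ Ioo 0 T, ∀ x : EuclideanSpace ℝ (Fin 3), ‖u t x‖ ≤ M / Real.sqrt (T - t)) :
    ∃ δ : ℝ, 0 < δ ∧ ∃ x₀ : EuclideanSpace ℝ (Fin 3), IsBackwardSingularPoint u ((T : ℝ), x₀) ∧
      ∀ K t₁ : ℝ, t₁ < T → ∃ t ∈ Ioo (max t₁ 0) T,
        ∃ x ∈ ball x₀ (δ * Real.sqrt (ν * (T - t))), K < ‖curl (u t) x‖ := by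
  obtain ⟨δ, hδ, x₀, hsing, H⟩ := typeI_concentratingBall_vorticity_unbounded hν hT hmax hLH hI
  refine ⟨δ, hδ, x₀, hsing, fun K t₁ ht₁ => ?_⟩
  obtain ⟨s, hs, hmono, hsT⟩ := exists_seq_Ioo_tendsto (max_lt ht₁ hT : max t₁ 0 < T)
  have hs' : ∀ n, s n ∈ Ioo 0 T := fun n => ⟨(le_max_right _ _).trans_lt (hs n).1, (hs n).2⟩
  obtain ⟨n, x, hx, hK⟩ := H s hs' hmono hsT K
  exact ⟨s n, hs n, x, hx, hK⟩

/-- **L55″ — UNDER GLOBAL TYPE I THE VORTEX DIRECTION HAS NO MODULUS OF CONTINUITY INSIDE THE SELF-SIMILAR BALLS.** With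
`δ`, `x₀` as above: for every `d > 0`, every `η : ℝ → ℝ` continuous with `η 0 = 0`, and every `t₁ < T`, there is
`t ∈ (t₁, T)` (also `t > 0`) at which the slice `u(t)` is NOT `η`-aligned over `{|ω| > d} ∩ B(x₀, δ√(ν(T − t)))`
(`¬ BarkerPrange2020.SliceAligned ν T u x₀ δ d η t`; Barker–Prange Thm. 3 (5.4) at the singular point of L37, along a
sequence inside the window). [cite: BarkerPrange2020Alignment, Thm. 3 (5.4) and Remark 15 (arXiv:1906.08225 §5.2 p. 18)]
[cite: CKN1982, Theorem B] -/
theorem typeI_concentratingBall_direction {ν T M : ℝ} (hν : 0 < ν) (hT : 0 < T)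
    {u : ℝ → EuclideanSpace ℝ (Fin 3) → EuclideanSpace ℝ (Fin 3)} {p : ℝ → EuclideanSpace ℝ (Fin 3) → ℝ}
    (hmax : IsMaximalSmoothSolution ν 0 u p T) (hLH : IsLerayHopfOn T ν 0 (u 0) u)
    (hI : ∀ t ∈ Ioo 0 T, ∀ x : EuclideanSpace ℝ (Fin 3), ‖u t x‖ ≤ M / Real.sqrt (T - t)) :
    ∃ δ : ℝ, 0 < δ ∧ ∃ x₀ : EuclideanSpace ℝ (Fin 3), IsBackwardSingularPoint u ((T : ℝ), x₀) ∧
      ∀ (d : ℝ) (η : ℝ → ℝ), 0 < d → Continuous η → η 0 = 0 →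
        ∀ t₁ : ℝ, t₁ < T → ∃ t ∈ Ioo (max t₁ 0) T, ¬ BarkerPrange2020.SliceAligned ν T u x₀ δ d η t := by
  obtain ⟨δ, hδ, H⟩ := barkerPrange2020_alignment_concentrating_typeI_general ν T M hν hT u p hmax.1 hLH hI
  obtain ⟨x₀, hsing⟩ := exists_isBackwardSingularPoint hν hT hmax hLH
  refine ⟨δ, hδ, x₀, hsing, fun d η hd hη hη0 t₁ ht₁ => ?_⟩
  obtain ⟨s, hs, hmono, hsT⟩ := exists_seq_Ioo_tendsto (max_lt ht₁ hT : max t₁ 0 < T)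
  have hs' : ∀ n, s n ∈ Ioo 0 T := fun n => ⟨(le_max_right _ _).trans_lt (hs n).1, (hs n).2⟩
  by_contra hall
  push Not at hall
  exact (H x₀ s hs' hmono hsT).2 d η hd hη hη0 (fun n => hall (s n) (hs n)) hsing

/-- **THE TYPE-I CONCENTRATING-BALL FACE, ASSEMBLED** (L55–L55″): under a global Type-I bound, one `δ > 0` and one focus
`x₀` carry (V) unbounded vorticity in `B(x₀, δ√(ν(T−t)))` on every terminal window and (D) the failure of every modulus
of the vortex direction over `{|ω| > d}` there, for every `d > 0`, on every terminal window.
[cite: BarkerPrange2020Alignment, Thm. 3 ((5.3)–(5.4)) and Remark 15 (arXiv:1906.08225 §5.2 p. 18)] -/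
theorem typeI_concentratingBall_face {ν T M : ℝ} (hν : 0 < ν) (hT : 0 < T)
    {u : ℝ → EuclideanSpace ℝ (Fin 3) → EuclideanSpace ℝ (Fin 3)} {p : ℝ → EuclideanSpace ℝ (Fin 3) → ℝ}
    (hmax : IsMaximalSmoothSolution ν 0 u p T) (hLH : IsLerayHopfOn T ν 0 (u 0) u)
    (hI : ∀ t ∈ Ioo 0 T, ∀ x : EuclideanSpace ℝ (Fin 3), ‖u t x‖ ≤ M / Real.sqrt (T - t)) :
    ∃ δ : ℝ, 0 < δ ∧ ∃ x₀ : EuclideanSpace ℝ (Fin 3), IsBackwardSingularPoint u ((T : ℝ), x₀) ∧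
      (∀ K t₁ : ℝ, t₁ < T → ∃ t ∈ Ioo (max t₁ 0) T,
        ∃ x ∈ ball x₀ (δ * Real.sqrt (ν * (T - t))), K < ‖curl (u t) x‖) ∧
      ∀ (d : ℝ) (η : ℝ → ℝ), 0 < d → Continuous η → η 0 = 0 →
        ∀ t₁ : ℝ, t₁ < T → ∃ t ∈ Ioo (max t₁ 0) T, ¬ BarkerPrange2020.SliceAligned ν T u x₀ δ d η t := by
  obtain ⟨δ, hδ, H⟩ := barkerPrange2020_alignment_concentrating_typeI_general ν T M hν hT u p hmax.1 hLH hI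
  obtain ⟨x₀, hsing⟩ := exists_isBackwardSingularPoint hν hT hmax hLH
  refine ⟨δ, hδ, x₀, hsing, fun K t₁ ht₁ => ?_, fun d η hd hη hη0 t₁ ht₁ => ?_⟩
  · obtain ⟨s, hs, hmono, hsT⟩ := exists_seq_Ioo_tendsto (max_lt ht₁ hT : max t₁ 0 < T)
    have hs' : ∀ n, s n ∈ Ioo 0 T := fun n => ⟨(le_max_right _ _).trans_lt (hs n).1, (hs n).2⟩
    by_contra hK
    push Not at hK
    refine (H x₀ s hs' hmono hsT).1 ⟨K, fun n x hx => ?_⟩ hsing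
    exact hK (s n) (hs n) x hx
  · obtain ⟨s, hs, hmono, hsT⟩ := exists_seq_Ioo_tendsto (max_lt ht₁ hT : max t₁ 0 < T)
    have hs' : ∀ n, s n ∈ Ioo 0 T := fun n => ⟨(le_max_right _ _).trans_lt (hs n).1, (hs n).2⟩
    by_contra hall
    push Not at hall
    exact (H x₀ s hs' hmono hsT).2 d η hd hη hη0 (fun n => hall (s n) (hs n)) hsing

end Summit.NavierStokesRegularity.FluidComputer.TypeIConcentratingBallFace

end
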